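import Literature.MathematicalPhysics.QuantumLattice.DWaveSourceNNNHoppingTwistedFlip
import Literature.MathematicalPhysics.QuantumLattice.DWaveSourceNNNHoppingWindowCertificateKKT
import Literature.MathematicalPhysics.QuantumLattice.HubbardNNNHoppingTwistedFlipWindowCertificate
import HarnessLib

/-!
# Window certificates for the pair-SOURCED `t–t'` torus with FLIP-TWISTED symmetry defects
# (sixteen point operations: `D₄ × ℤ₂^{flip}` twisted by the gauge quarter turn), eigenvector and KKT forms

Topic `MathematicalPhysics/QuantumLattice`, family `hubbard`. Everything here is PROVED; no definition and no
named fact. Twin of `DWaveSourceNNNHoppingTwistedWindowCertificate` for the family WITH SPIN EXCHANGE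
`T((v, γ), f, m) = U_v D_γ F^f 𝒢_{j(γ)+f+2m}` (`TwistedFlipSpaceGroupUnitary`; it commutes with
`A_L = dWaveSourceTorusTT' L tp U μ h` for EVERY `S ⊆ D₄`, `DWaveSourceNNNHoppingTwistedFlip`) — the identification
under which the sourced menus of cell hubbard-cq are built (engine obsb ≥ 0.3.0: `gauge_twist`, `spin_flip`). The
symmetry defects read `bₗ • (φₗ • Γ(incl)(Γ(d4Emb γₗ wₗ)(F^{fₗ} Wₗ)) − Γ(incl) Wₗ)` with `Wₗ = ladderWord (yw l)`,
`F^{f} W = spinSwapIter f W`, `φₗ = gaugePhase (twistFlipExp γₗ fₗ mₗ) (yw l) = i^{(j(γₗ)+fₗ+2mₗ)·q(Wₗ)}`; the `S^z`-charged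
ladder words `Σⱼ b'ⱼ wⱼ` are still admissible rows (each flip-twisted orbit vector of an `S^z`-eigenvector is an
`S^z`-eigenvector).

* `re_orbitState_ge_of_twistedFlip_sourced_window_certificate_TT'_ineq` — eigenvector form, energy term
  `κ (u·1 − E^{src,tt'})`: `c − Σₖ ‖aₖ‖ + κ (u − E/L²) ≤ Re ω̄^{tw,F}_ψ(Γ(ι_{Λ',L}) X)`;
* `re_orbitState_fermionEmbed_kktForm_sourced_TT'_nonneg_twistedFlipFlip` — the pulled-back window KKT block is `≥ 0` in the
  flip-twisted orbit state of every ground vector (ARBITRARY generators);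
* `re_orbitState_ge_of_twistedFlip_sourced_window_certificate_TT'_kkt_ineq` — ground-state form with the KKT block.

Honest framing (cell hubbard-cq, wording W1): a finite-`h` response bound is a «finite-h response (certified)»
row at FIXED `μ`, NOT an order parameter and NOT a phase word. No certificate exists in this file.

## References
* J. Wang et al., Phys. Rev. X 14 (2024) 031006, §III. [cite: WangEtAl2024, §III]
* X. Han, arXiv:2006.06002 (2020), §3. [cite: Han2020Bootstrap, §3]
* M. Araújo et al., arXiv:2311.18707, §3.2 Prop. 11. [cite: AraujoEtAl2023, §3.2 Prop. 11]
* O. Bratteli, D. W. Robinson II (1997), §5.2.2, Prop. 5.3.19, §6.2.4. [cite: BratteliRobinsonII1997, §5.2.2]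
* G. Benfatto, A. Giuliani, V. Mastropietro, Ann. Henri Poincaré 7 (2006) 809, §2.1. [cite: BenfattoGiulianiMastropietro2006, §2.1]
* T. Koma, H. Tasaki, J. Stat. Phys. 76 (1994) 745, §1. [cite: KomaTasaki1994, §1]
-/

noncomputable section

namespace Literature.MathematicalPhysics.QuantumLattice

open Matrix Finset HubbardWave0 Literature.Probability.LatticeModels
open Literature.MathematicalPhysics.QuantumManyBody.StateRelaxation
open scoped ComplexOrder BigOperators

section TorusSourced

variable {L : ℕ} [NeZero L]

/-- (Local to this section, as in `DWaveSourceNNNHoppingWindowCertificate`.) [folklore] -/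
local instance (priority := high) instDecidableEqFermionTorusSrcTwFWin : DecidableEq (FermionTorus 2 L) :=
  LinearOrder.toDecidableEq

/-- **Twisted sourced `t–t'` window certificate with energy constraint ⇒ twisted-orbit-averaged expectation of a
local observable in every `S^z`-eigenvector eigenstate of every large pair-sourced torus.** Regions
`Λ ⊆ Λ'` (`thicken Λ 1 ⊆ Λ'`, `thicken {0} 1 ⊆ Λ'`, pair region `⊆ Λ'`); the identity in `𝔄_{Λ'}`
`X − c·1 − κ (u·1 − E^{src,tt'}) = Σ Λₐᵦ Oₐᴴ O_b + (Σₖ [H^{src,tt'}_{Λ'}, Γ(incl)Bₖ]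
  + Σₗ bₗ • (φₗ • Γ(incl)(Γ(d4Emb γₗ wₗ) Wₗ) − Γ(incl) Wₗ) + Σⱼ b'ⱼ wⱼ) + (Σₘ dₘ • (Vₘᴴ − Vₘ) + Σₖ aₖ • vₖ)`
with TWISTED defects (`Wₗ = ladderWord (yw l) ∈ 𝔄_Λ` spin-exchanged `fₗ` times, `φₗ = gaugePhase (twistFlipExp γₗ fₗ mₗ) (yw l)`, `γₗ ∈ S`),
`S^z`-charged ladder words `wⱼ`, real `dₘ`, ladder words `vₖ`. Then for every `L ≥ 3` with `x ↦ x mod L` injective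
on `thicken Λ' 1`, every finite `S ∋ 1` closed under multiplication (ANY subset of `D₄`, the quarter turn allowed),
and every unit `ψ ∈ fockSpinZSector M` with `A_L ψ = E ψ`:
`c − Σₖ ‖aₖ‖ + κ (u − E/L²) ≤ Re ω̄^{tw,F}_ψ(Γ(ι_{Λ',L}) X)`, `ω̄^{tw,F}_ψ = orbitState (twistedFlipSpaceGroupUnitary S) ψ`.
[cite: WangEtAl2024, §III] [cite: Han2020Bootstrap, §3] -/
theorem re_orbitState_ge_of_twistedFlip_sourced_window_certificate_TT'_ineq (tp U μ h : ℝ) (hL : 3 ≤ L) {M : ℝ}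
    {Λ Λ' : Finset (Site 2)} (hΛ : Λ ⊆ Λ') (h8 : thicken Λ 1 ⊆ Λ')
    (h0 : thicken ({0} : Finset (Site 2)) 1 ⊆ Λ') (hz : (0 : Site 2) ∈ Λ')
    (hP : pairRegion (insert (0 : Site 2) unitSteps) 0 ⊆ Λ')
    (hInj : Set.InjOn (Torus.proj (d := 2) L) ↑(thicken Λ' 1))
    (hInj' : Set.InjOn (Torus.proj (d := 2) L) ↑Λ')
    {S : Finset (DihedralGroup 4)} (h1 : (1 : DihedralGroup 4) ∈ S) (hmul : ∀ a ∈ S, ∀ b ∈ S, a * b ∈ S)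
    {ψ : Fock (Orb (FermionTorus 2 L))} (hψK : ψ ∈ fockSpinZSector (Λ := FermionTorus 2 L) M)
    (hψ1 : star ψ ⬝ᵥ ψ = 1) {E : ℝ} (hHψ : dWaveSourceTorusTT' L tp U μ h *ᵥ ψ = (E : ℂ) • ψ)
    (Xw : FermionOp Λ') (κ u : ℝ)
    {m : Type*} [Fintype m] [DecidableEq m] {Λm : Matrix m m ℂ} (hΛm : Λm.PosSemidef)
    (O : m → FermionOp Λ')
    {κ' : Type*} (s : Finset κ') (B : κ' → FermionOp Λ)
    {ι : Type*} (tt : Finset ι) (γ : ι → DihedralGroup 4) (hγS : ∀ l ∈ tt, γ l ∈ S) (wv : ι → Site 2)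
    (fl mt : ι → Fin 2) (hsh : ∀ l, d4ShiftSet (γ l) (wv l) Λ ⊆ Λ') (bb : ι → ℂ)
    (yw : ι → List (Orb (PolySite Λ) × Bool))
    {ρ : Type*} (uu : Finset ρ) (b : ρ → ℂ) (cw : ρ → List (Orb (PolySite Λ') × Bool))
    (hcw : ∀ j ∈ uu, ladderSpinCharge (cw j) ≠ 0)
    {δ : Type*} (ah : Finset δ) (dc : δ → ℝ) (V : δ → FermionOp Λ')
    {κ'' : Type*} (w : Finset κ'') (a : κ'' → ℂ) (word : κ'' → List (Orb (PolySite Λ') × Bool)) {c : ℝ}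
    (hcert : Xw - (c : ℂ) • (1 : FermionOp Λ') -
        ((κ : ℝ) : ℂ) • (((u : ℝ) : ℂ) • (1 : FermionOp Λ') -
          (fermionEmbed (PolySite.incl h0) ((hubbardTTPrimeFermionInteraction 1 tp U).meanEnergyObs 1) -
            (μ : ℂ) • ∑ σ : Fin 2, nAt 0 hz σ -
            (h : ℂ) • (fermionEmbed (PolySite.incl hP) (localPairAt (insert (0 : Site 2) unitSteps) dWaveFormFactor 0) +
              (fermionEmbed (PolySite.incl hP) (localPairAt (insert (0 : Site 2) unitSteps) dWaveFormFactor 0))ᴴ))) =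
      gramForm Λm O +
        (∑ k ∈ s, (pairSourceWindowHamiltonianTT' dWaveFormFactor Λ' tp U μ h * fermionEmbed (PolySite.incl hΛ) (B k) -
            fermionEmbed (PolySite.incl hΛ) (B k) * pairSourceWindowHamiltonianTT' dWaveFormFactor Λ' tp U μ h) +
          ∑ l ∈ tt, bb l • (gaugePhase (twistFlipExp (γ l) (fl l) (mt l)) (yw l) •
              fermionEmbed (PolySite.incl (hsh l))
                (fermionEmbed (PolySite.d4Emb (γ l) (wv l) Λ) (spinSwapIter (fl l).val (ladderWord (yw l)))) -
            fermionEmbed (PolySite.incl hΛ) (ladderWord (yw l))) +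
          ∑ j ∈ uu, b j • ladderWord (cw j)) +
        (∑ m' ∈ ah, ((dc m' : ℝ) : ℂ) • ((V m')ᴴ - V m') + ∑ k ∈ w, a k • ladderWord (word k))) :
    c - ∑ k ∈ w, ‖a k‖ + κ * (u - E / (L : ℝ) ^ 2) ≤
      (orbitState (twistedFlipSpaceGroupUnitary S) ψ (fermionEmbed (PolySite.toTorusEmb L hInj') Xw)).re := by
  have hInjΛ : Set.InjOn (Torus.proj (d := 2) L) ↑Λ := hInj'.mono (by exact_mod_cast hΛ)
  set Γ' := fermionEmbed (PolySite.toTorusEmb L hInj') with hΓ'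
  set ΓΛ := fermionEmbed (PolySite.toTorusEmb L hInjΛ) with hΓΛ
  set H := dWaveSourceTorusTT' L tp U μ h with hH
  set X := Γ' (fermionEmbed (PolySite.incl h0) ((hubbardTTPrimeFermionInteraction 1 tp U).meanEnergyObs 1) -
      (μ : ℂ) • ∑ σ : Fin 2, nAt 0 hz σ -
      (h : ℂ) • (fermionEmbed (PolySite.incl hP) (localPairAt (insert (0 : Site 2) unitSteps) dWaveFormFactor 0) +
        (fermionEmbed (PolySite.incl hP) (localPairAt (insert (0 : Site 2) unitSteps) dWaveFormFactor 0))ᴴ)) with hX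
  have hsum : ∑ v' : TorusSite 2 L, (fockTranslate v').val * X * (fockTranslate v').valᴴ = H := by
    rw [hH, hX, hΓ']
    exact sum_conj_fockTranslate_pairSourceObjectiveTT'_dWave L h0 hz hP hInj' hL tp U μ h
  -- symmetry family: the torus images of the words `W_l`, with their coefficients
  set emb0 : Orb (PolySite Λ) × Bool → Orb (FermionTorus 2 L) × Bool :=
    fun p => (Orb.embMap (PolySite.toTorusEmb L hInjΛ) p.1, p.2) with hemb0
  set Yt : ι → Matrix (Finset (Orb (FermionTorus 2 L))) (Finset (Orb (FermionTorus 2 L))) ℂ :=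
    fun l => bb l • ΓΛ (ladderWord (yw l)) with hYt
  have hYtw : ∀ l, ΓΛ (ladderWord (yw l)) = ladderWord ((yw l).map emb0) := fun l => by
    rw [hΓΛ, fermionEmbed_ladderWord]
  set emb : Orb (PolySite Λ') × Bool → Orb (FermionTorus 2 L) × Bool :=
    fun p => (Orb.embMap (PolySite.toTorusEmb L hInj') p.1, p.2) with hemb
  -- `S^z`-charged words: torus images and their `S^z` commutators
  set Wc : ρ → Matrix (Finset (Orb (FermionTorus 2 L))) (Finset (Orb (FermionTorus 2 L))) ℂ :=
    fun j => b j • ladderWord ((cw j).map emb) with hWc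
  set sc : ρ → ℂ := fun j => ((ladderSpinCharge ((cw j).map emb) : ℤ) : ℂ) / 2 with hsc
  have hsc0 : ∀ j ∈ uu, sc j ≠ 0 := fun j hj => by
    rw [hsc]; dsimp only
    rw [hemb, ladderSpinCharge_map_embMap]
    exact div_ne_zero (Int.cast_ne_zero.2 (hcw j hj)) two_ne_zero
  have hWcS : ∀ j ∈ uu, HubbardWave0.spinZ * Wc j - Wc j * HubbardWave0.spinZ = sc j • Wc j := fun j _ => by
    rw [hWc, hsc]; dsimp only
    rw [Matrix.mul_smul, Matrix.smul_mul, ← smul_sub, spinZ_comm_ladderWord, smul_comm]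
  have hcharged : ∀ j ∈ uu, Γ' (b j • ladderWord (cw j)) = Wc j := fun j _ => by
    rw [fermionEmbed_smul, fermionEmbed_ladderWord]
  set Mw : κ'' → Matrix (Finset (Orb (FermionTorus 2 L))) (Finset (Orb (FermionTorus 2 L))) ℂ :=
    fun k => ladderWord ((word k).map emb) with hMw
  have hMc : ∀ k ∈ w, (Mw k).IsContraction := fun k _ => by
    rw [hMw]; dsimp only; rw [ladderWord_eq_prod]; exact isContraction_prod_ladder _
  -- the flip-twisted defects, pulled back into the torus
  have h2l : ∀ l ∈ tt, Γ' (bb l • (gaugePhase (twistFlipExp (γ l) (fl l) (mt l)) (yw l) •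
        fermionEmbed (PolySite.incl (hsh l))
          (fermionEmbed (PolySite.d4Emb (γ l) (wv l) Λ) (spinSwapIter (fl l).val (ladderWord (yw l)))) -
        fermionEmbed (PolySite.incl hΛ) (ladderWord (yw l)))) =
      (fockTranslate (Torus.proj L (wv l))).val * (fockD4 (L := L) (γ l)).val * fockSpinFlip ^ (fl l).val *
          fockGauge (twistFlipExp (γ l) (fl l) (mt l)) * Yt l *
        ((fockTranslate (Torus.proj L (wv l))).val * (fockD4 (L := L) (γ l)).val * fockSpinFlip ^ (fl l).val *
          fockGauge (twistFlipExp (γ l) (fl l) (mt l)))ᴴ - Yt l := by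
    intro l _
    set UD := (fockTranslate (Torus.proj L (wv l))).val * (fockD4 (L := L) (γ l)).val with hUD
    set Fk : Matrix (Finset (Orb (FermionTorus 2 L))) _ ℂ := fockSpinFlip ^ (fl l).val with hFk
    set Ge : Matrix (Finset (Orb (FermionTorus 2 L))) _ ℂ := fockGauge (twistFlipExp (γ l) (fl l) (mt l)) with hGe
    have hgauge : Ge * Yt l * Geᴴ = gaugePhase (twistFlipExp (γ l) (fl l) (mt l)) (yw l) • Yt l := by
      rw [hYt]; dsimp only
      rw [Matrix.mul_smul, Matrix.smul_mul, hYtw l, hGe, fockGauge_conj_ladderWord, hemb0, gaugePhase_map_fst, smul_comm]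
    have hrhs : UD * Fk * Ge * Yt l * (UD * Fk * Ge)ᴴ =
        gaugePhase (twistFlipExp (γ l) (fl l) (mt l)) (yw l) • (UD * (Fk * Yt l * Fkᴴ) * UDᴴ) := by
      rw [conjTranspose_mul, conjTranspose_mul,
        show UD * Fk * Ge * Yt l * (Geᴴ * (Fkᴴ * UDᴴ)) = UD * (Fk * (Ge * Yt l * Geᴴ) * Fkᴴ) * UDᴴ by
          simp only [Matrix.mul_assoc],
        hgauge, Matrix.mul_smul, Matrix.smul_mul, Matrix.mul_smul, Matrix.smul_mul]
    rw [hrhs, map_smul, map_sub, map_smul, fermionEmbed_toTorusEmb_incl (hsh l) hInj',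
      fermionEmbed_toTorusEmb_incl hΛ hInj',
      fermionEmbed_toTorusEmb_d4Emb (γ l) (wv l) hInjΛ (hInj'.mono (by exact_mod_cast (hsh l)))
        (spinSwapIter (fl l).val (ladderWord (yw l))),
      ← d4Affine_conj, fermionEmbed_toTorusEmb_spinSwapIter hInjΛ, hYt]
    dsimp only
    rw [hΓΛ, hUD, hFk]
    simp only [Matrix.mul_smul, Matrix.smul_mul, smul_sub, Matrix.mul_assoc]
    rw [smul_comm]
  have htorus : Γ' Xw - (c : ℂ) • (1 : Matrix (Finset (Orb (FermionTorus 2 L))) (Finset (Orb (FermionTorus 2 L))) ℂ) -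
      ((κ : ℝ) : ℂ) • (((u : ℝ) : ℂ) •
        (1 : Matrix (Finset (Orb (FermionTorus 2 L))) (Finset (Orb (FermionTorus 2 L))) ℂ) - X) =
      gramForm Λm (fun i => Γ' (O i)) +
        (∑ k ∈ s, (H * Γ' (fermionEmbed (PolySite.incl hΛ) (B k)) - Γ' (fermionEmbed (PolySite.incl hΛ) (B k)) * H) +
          ∑ l ∈ tt, ((fockTranslate (Torus.proj L (wv l))).val * (fockD4 (L := L) (γ l)).val * fockSpinFlip ^ (fl l).val *
              fockGauge (twistFlipExp (γ l) (fl l) (mt l)) * Yt l *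
              ((fockTranslate (Torus.proj L (wv l))).val * (fockD4 (L := L) (γ l)).val * fockSpinFlip ^ (fl l).val *
                fockGauge (twistFlipExp (γ l) (fl l) (mt l)))ᴴ - Yt l) +
          ∑ j ∈ uu, Wc j) +
        (∑ m' ∈ ah, ((dc m' : ℝ) : ℂ) • ((Γ' (V m'))ᴴ - Γ' (V m')) + ∑ k ∈ w, a k • Mw k) := by
    have key := congrArg Γ' hcert
    rw [fermionEmbed_sub, fermionEmbed_sub, fermionEmbed_smul, fermionEmbed_one, fermionEmbed_smul,
      fermionEmbed_sub, fermionEmbed_smul, fermionEmbed_one] at key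
    have h1' : Γ' (∑ k ∈ s, (pairSourceWindowHamiltonianTT' dWaveFormFactor Λ' tp U μ h * fermionEmbed (PolySite.incl hΛ) (B k) -
        fermionEmbed (PolySite.incl hΛ) (B k) * pairSourceWindowHamiltonianTT' dWaveFormFactor Λ' tp U μ h)) =
        ∑ k ∈ s, (H * Γ' (fermionEmbed (PolySite.incl hΛ) (B k)) - Γ' (fermionEmbed (PolySite.incl hΛ) (B k)) * H) := by
      rw [fermionEmbed_sum]
      refine Finset.sum_congr rfl fun k _ => ?_
      rw [hH, hΓ', dWaveSourceTorusTT'_commutator_fermionEmbed L hΛ h8 hInj tp U μ h (B k)]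
    have h2 : Γ' (∑ l ∈ tt, bb l • (gaugePhase (twistFlipExp (γ l) (fl l) (mt l)) (yw l) •
          fermionEmbed (PolySite.incl (hsh l))
            (fermionEmbed (PolySite.d4Emb (γ l) (wv l) Λ) (spinSwapIter (fl l).val (ladderWord (yw l)))) -
          fermionEmbed (PolySite.incl hΛ) (ladderWord (yw l)))) =
        ∑ l ∈ tt, ((fockTranslate (Torus.proj L (wv l))).val * (fockD4 (L := L) (γ l)).val * fockSpinFlip ^ (fl l).val *
              fockGauge (twistFlipExp (γ l) (fl l) (mt l)) * Yt l *
            ((fockTranslate (Torus.proj L (wv l))).val * (fockD4 (L := L) (γ l)).val * fockSpinFlip ^ (fl l).val *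
              fockGauge (twistFlipExp (γ l) (fl l) (mt l)))ᴴ - Yt l) := by
      rw [fermionEmbed_sum]
      exact Finset.sum_congr rfl h2l
    have h3 : Γ' (∑ j ∈ uu, b j • ladderWord (cw j)) = ∑ j ∈ uu, Wc j := by
      rw [fermionEmbed_sum]
      exact Finset.sum_congr rfl hcharged
    have h4 : Γ' (∑ m' ∈ ah, ((dc m' : ℝ) : ℂ) • ((V m')ᴴ - V m')) =
        ∑ m' ∈ ah, ((dc m' : ℝ) : ℂ) • ((Γ' (V m'))ᴴ - Γ' (V m')) := by
      rw [fermionEmbed_sum]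
      refine Finset.sum_congr rfl fun m' _ => ?_
      rw [fermionEmbed_smul, fermionEmbed_sub, hΓ', fermionEmbed_conjTranspose]
    have h5 : Γ' (∑ k ∈ w, a k • ladderWord (word k)) = ∑ k ∈ w, a k • Mw k := by
      rw [fermionEmbed_sum]
      refine Finset.sum_congr rfl fun k _ => ?_
      rw [fermionEmbed_smul, hMw, fermionEmbed_ladderWord]
    rw [hX, key, fermionEmbed_add, fermionEmbed_add, fermionEmbed_add, fermionEmbed_add, fermionEmbed_add, hΓ',
      fermionEmbed_gramForm, ← hΓ', h1', h2, h3, h4, h5]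
  have hmain := dWaveSourceTorusTT'_re_orbitState_ge_of_twistedFlip_local_certificate_ineq tp U μ h h1 hmul hψK hψ1 hHψ
    (Γ' Xw) X hsum κ u hΛm (fun i => Γ' (O i)) s (fun k => Γ' (fermionEmbed (PolySite.incl hΛ) (B k))) tt γ hγS
    (fun l => Torus.proj L (wv l)) fl mt Yt uu Wc sc hsc0 hWcS ah dc (fun m' => Γ' (V m')) w a Mw hMc htorus
  exact hmain

/-- **The sourced window KKT element is nonnegative in the TWISTED orbit state of every ground vector of the
pair-sourced `t–t'` torus — for ARBITRARY window generators and EVERY label set `S ⊆ D₄`.**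
`0 ≤ Re ω̄^{tw,F}_ψ(Γ(ι_{Λ',L}) kktForm H^{src,tt'}_{Λ'} G (Γ(incl) ∘ B))` for `G ⪰ 0`, `B_b ∈ 𝔄_Λ`, `A_L ψ = E₀ ψ`
(`dWaveSourceTorusTT'_commutator_fermionEmbed`; the twisted family commutes with `A_L`,
`twistedFlipSpaceGroupUnitary_mul_dWaveSourceTorusTT'`). [cite: BratteliRobinsonII1997, Prop. 5.3.19]
[cite: AraujoEtAl2023, §3.2 Prop. 11] -/
theorem re_orbitState_fermionEmbed_kktForm_sourced_TT'_nonneg_twistedFlip (tp U μ h : ℝ)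
    {Λ Λ' : Finset (Site 2)} (hΛ : Λ ⊆ Λ') (h8 : thicken Λ 1 ⊆ Λ')
    (hInj : Set.InjOn (Torus.proj (d := 2) L) ↑(thicken Λ' 1))
    (hInj' : Set.InjOn (Torus.proj (d := 2) L) ↑Λ')
    (S : Finset (DihedralGroup 4))
    {ψ : Fock (Orb (FermionTorus 2 L))}
    (hHψ : dWaveSourceTorusTT' L tp U μ h *ᵥ ψ =
      (((dWaveSourceTorusTT' L tp U μ h).groundEnergy : ℝ) : ℂ) • ψ)
    {β : Type*} [Fintype β] [DecidableEq β] {G : Matrix β β ℂ} (hG : G.PosSemidef)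
    (Bk : β → FermionOp Λ) :
    0 ≤ (orbitState (twistedFlipSpaceGroupUnitary S) ψ
        (fermionEmbed (PolySite.toTorusEmb L hInj')
          (kktForm (pairSourceWindowHamiltonianTT' dWaveFormFactor Λ' tp U μ h) G
            (fun b => fermionEmbed (PolySite.incl hΛ) (Bk b))))).re := by
  have hH : (dWaveSourceTorusTT' L tp U μ h).IsHermitian := dWaveSourceTorusTT'_isHermitian L tp U μ h
  set ω' : FermionOp Λ' →ₗ[ℂ] ℂ :=
    orbitState (twistedFlipSpaceGroupUnitary S) ψ ∘ₗ (fermionEmbed (PolySite.toTorusEmb L hInj')).toLinearMap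
    with hω'
  have hω'app : ∀ x, ω' x = orbitState (twistedFlipSpaceGroupUnitary S) ψ
      (fermionEmbed (PolySite.toTorusEmb L hInj') x) := fun _ => rfl
  have hk := re_map_kktForm_nonneg ω' (pairSourceWindowHamiltonianTT' dWaveFormFactor Λ' tp U μ h)
    hG (fun b => fermionEmbed (PolySite.incl hΛ) (Bk b)) fun wc => ?_
  · rwa [hω'app] at hk
  have hsum : ∑ j, wc j • fermionEmbed (PolySite.incl hΛ) (Bk j) =
      fermionEmbed (PolySite.incl hΛ) (∑ j, wc j • Bk j) := by
    rw [fermionEmbed_sum]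
    exact Finset.sum_congr rfl fun j _ => (fermionEmbed_smul _ _ _).symm
  rw [hsum, hω'app, Matrix.star_eq_conjTranspose, fermionEmbed_mul, fermionEmbed_conjTranspose,
    ← dWaveSourceTorusTT'_commutator_fermionEmbed L hΛ h8 hInj tp U μ h (∑ j, wc j • Bk j)]
  exact re_orbitState_conjTranspose_mul_commutator_nonneg_of_groundState hH
    (fun g => twistedFlipSpaceGroupUnitary_mul_dWaveSourceTorusTT' S tp U μ h g) hHψ

/-- Moving a summand of the right-hand side of a certificate identity into the objective:
`X − c − K = R + k ⇒ (X − k) − c − K = R`. [folklore] -/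
private theorem cert_sub_kkt_src_twf {A : Type*} [AddCommGroup A] {X c K R k : A}
    (h : X - c - K = R + k) : X - k - c - K = R := by
  rw [eq_sub_of_add_eq h.symm]
  abel

/-- **Twisted sourced `t–t'` window certificate with energy constraint AND a KKT block ⇒ twisted-orbit-averaged
expectation of a local observable in every `S^z`-eigenvector GROUND state of every large pair-sourced torus.**
Data as in `re_orbitState_ge_of_twistedFlip_sourced_window_certificate_TT'_ineq` plus a multiplier `G ⪰ 0` and ARBITRARY
generators `B_b ∈ 𝔄_Λ`; the identity carries the extra summand `+ kktForm H^{src,tt'}_{Λ'} G (Γ(incl) ∘ B)` on the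
right. Then for every `L ≥ 3` with `x ↦ x mod L` injective on `thicken Λ' 1`, every finite `S ∋ 1` closed under
multiplication (ANY subset of `D₄`), `γₗ ∈ S`, and every unit `ψ ∈ fockSpinZSector M` with `A_L ψ = E₀ ψ`:
`c − Σₖ ‖aₖ‖ + κ (u − E₀/L²) ≤ Re ω̄^{tw,F}_ψ(Γ(ι_{Λ',L}) X)`. [cite: WangEtAl2024, §III] [cite: AraujoEtAl2023, §3.2 Prop. 11] -/
theorem re_orbitState_ge_of_twistedFlip_sourced_window_certificate_TT'_kkt_ineq (tp U μ h : ℝ) (hL : 3 ≤ L) {M : ℝ}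
    {Λ Λ' : Finset (Site 2)} (hΛ : Λ ⊆ Λ') (h8 : thicken Λ 1 ⊆ Λ')
    (h0 : thicken ({0} : Finset (Site 2)) 1 ⊆ Λ') (hz : (0 : Site 2) ∈ Λ')
    (hP : pairRegion (insert (0 : Site 2) unitSteps) 0 ⊆ Λ')
    (hInj : Set.InjOn (Torus.proj (d := 2) L) ↑(thicken Λ' 1))
    (hInj' : Set.InjOn (Torus.proj (d := 2) L) ↑Λ')
    {S : Finset (DihedralGroup 4)} (h1 : (1 : DihedralGroup 4) ∈ S) (hmul : ∀ a ∈ S, ∀ b ∈ S, a * b ∈ S)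
    {ψ : Fock (Orb (FermionTorus 2 L))} (hψK : ψ ∈ fockSpinZSector (Λ := FermionTorus 2 L) M)
    (hψ1 : star ψ ⬝ᵥ ψ = 1)
    (hHψ : dWaveSourceTorusTT' L tp U μ h *ᵥ ψ =
      (((dWaveSourceTorusTT' L tp U μ h).groundEnergy : ℝ) : ℂ) • ψ)
    (Xw : FermionOp Λ') (κ u : ℝ)
    {m : Type*} [Fintype m] [DecidableEq m] {Λm : Matrix m m ℂ} (hΛm : Λm.PosSemidef)
    (O : m → FermionOp Λ')
    {κ' : Type*} (s : Finset κ') (B : κ' → FermionOp Λ)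
    {ι : Type*} (tt : Finset ι) (γ : ι → DihedralGroup 4) (hγS : ∀ l ∈ tt, γ l ∈ S) (wv : ι → Site 2)
    (fl mt : ι → Fin 2) (hsh : ∀ l, d4ShiftSet (γ l) (wv l) Λ ⊆ Λ') (bb : ι → ℂ)
    (yw : ι → List (Orb (PolySite Λ) × Bool))
    {ρ : Type*} (uu : Finset ρ) (b : ρ → ℂ) (cw : ρ → List (Orb (PolySite Λ') × Bool))
    (hcw : ∀ j ∈ uu, ladderSpinCharge (cw j) ≠ 0)
    {δ : Type*} (ah : Finset δ) (dc : δ → ℝ) (V : δ → FermionOp Λ')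
    {κ'' : Type*} (w : Finset κ'') (a : κ'' → ℂ) (word : κ'' → List (Orb (PolySite Λ') × Bool))
    {β : Type*} [Fintype β] [DecidableEq β] {G : Matrix β β ℂ} (hG : G.PosSemidef)
    (Bk : β → FermionOp Λ) {c : ℝ}
    (hcert : Xw - (c : ℂ) • (1 : FermionOp Λ') -
        ((κ : ℝ) : ℂ) • (((u : ℝ) : ℂ) • (1 : FermionOp Λ') -
          (fermionEmbed (PolySite.incl h0) ((hubbardTTPrimeFermionInteraction 1 tp U).meanEnergyObs 1) -
            (μ : ℂ) • ∑ σ : Fin 2, nAt 0 hz σ -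
            (h : ℂ) • (fermionEmbed (PolySite.incl hP) (localPairAt (insert (0 : Site 2) unitSteps) dWaveFormFactor 0) +
              (fermionEmbed (PolySite.incl hP) (localPairAt (insert (0 : Site 2) unitSteps) dWaveFormFactor 0))ᴴ))) =
      gramForm Λm O +
        (∑ k ∈ s, (pairSourceWindowHamiltonianTT' dWaveFormFactor Λ' tp U μ h * fermionEmbed (PolySite.incl hΛ) (B k) -
            fermionEmbed (PolySite.incl hΛ) (B k) * pairSourceWindowHamiltonianTT' dWaveFormFactor Λ' tp U μ h) +
          ∑ l ∈ tt, bb l • (gaugePhase (twistFlipExp (γ l) (fl l) (mt l)) (yw l) •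
              fermionEmbed (PolySite.incl (hsh l))
                (fermionEmbed (PolySite.d4Emb (γ l) (wv l) Λ) (spinSwapIter (fl l).val (ladderWord (yw l)))) -
            fermionEmbed (PolySite.incl hΛ) (ladderWord (yw l))) +
          ∑ j ∈ uu, b j • ladderWord (cw j)) +
        (∑ m' ∈ ah, ((dc m' : ℝ) : ℂ) • ((V m')ᴴ - V m') + ∑ k ∈ w, a k • ladderWord (word k)) +
        kktForm (pairSourceWindowHamiltonianTT' dWaveFormFactor Λ' tp U μ h) G
          (fun b' => fermionEmbed (PolySite.incl hΛ) (Bk b'))) :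
    c - ∑ k ∈ w, ‖a k‖ + κ * (u - (dWaveSourceTorusTT' L tp U μ h).groundEnergy / (L : ℝ) ^ 2) ≤
      (orbitState (twistedFlipSpaceGroupUnitary S) ψ (fermionEmbed (PolySite.toTorusEmb L hInj') Xw)).re := by
  have hmain := re_orbitState_ge_of_twistedFlip_sourced_window_certificate_TT'_ineq tp U μ h hL hΛ h8 h0 hz hP hInj hInj'
    h1 hmul hψK hψ1 hHψ
    (Xw - kktForm (pairSourceWindowHamiltonianTT' dWaveFormFactor Λ' tp U μ h) G
      (fun b' => fermionEmbed (PolySite.incl hΛ) (Bk b'))) κ u hΛm O s B tt γ hγS wv fl mt hsh bb yw uu b cw hcw ah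
    dc V w a word (cert_sub_kkt_src_twf hcert)
  have hkkt := re_orbitState_fermionEmbed_kktForm_sourced_TT'_nonneg_twistedFlip tp U μ h hΛ h8 hInj hInj' S hHψ hG Bk
  rw [map_sub, map_sub, Complex.sub_re] at hmain
  linarith

end TorusSourced

end Literature.MathematicalPhysics.QuantumLattice

end
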